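import Literature.NumberTheory.LFunctions.Zhang2022.DHChainBarrierPrimes
import Literature.NumberTheory.LFunctions.Zhang2022.DHMenuConsistentP4

/-!
# Zhang (2022), rung F-S3, family B-dh — calculus kit for the prime (A)-world `primeWorld D χ` of
# `DHChainBarrierPrimes`, and rows S5 (clauses 1–2) and P6 of `DH.PrimeMenu (world D χ) (primeWorld D χ)`

Y. Zhang, *Discrete mean estimates and the Landau–Siegel zero*, arXiv:2211.02515v1 [Zhang2022LandauSiegel] — an unrefereed
manuscript under adjudication. **The programme SEARCHES and TYPES; no claim about Landau–Siegel zeros, Theorems 1–2 of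
arXiv:2211.02515 or a repaired Margin232 until a kernel theorem says so.** Nothing here is a statement about primes or about a
Dirichlet `L`-function: `DH.primeWorld D χ` (p464158) is explicit DATA — `θ_W(x;q,a,h) = (1/φ(q)) ∫_{max(x−h,1)}^{max(x,1)}
(1 − s(q,a)·t^{β₁−1}) dt` on units `a`, `0` on non-units, `s(q,a) = siegelSign D χ q a`, `β₁ = betaExc D` — and every theorem
below is elementary calculus / bookkeeping about that data. Cell `landau-siegel`, sub-cell E, row S-E-p4-6 (ls-barrier-plan g1
split of record 2026-08-26T21:28:23Z for the §E target E-18b `DH.menuConsistentPrimes_holds : MenuConsistentPrimes`); the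
θ-rows P2–P5 (`DHMenuConsistentPrimesP`, ls-Bdh-typer-2) and the ψ-rows P1 / S5 clause 3 (`DHMenuConsistentPrimesPsi`,
ls-Bdh-typer-1) import this kit; `abs_siegelSign_le`, `siegelSign_of_not_dvd`, `primeWorld_theta_of_not_dvd`
(`DHChainBarrierPrimes`) and `betaExc_window`, `half_lt_betaExc` (`DHMenuConsistentP4`) are cited by name, not restated.

## Contents (`s` with `|s| ≤ 1`, exponent `r ≤ 0`; `θ_W := (primeWorld D χ).theta`, `φ := Nat.totient`)

* §1 the integrand `1 − s·t^r` on `t ≥ 1`: `one_sub_mul_rpow_nonneg` (`≥ 0`), `one_sub_mul_rpow_le_two` (`≤ 2`),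
  `one_sub_mul_rpow_pos` (`> 0` for `r < 0`, `t > 1`); `intervalIntegrable_one_sub_mul_rpow`.
* §2 its interval integral over `[u, v]`, `1 ≤ u ≤ v`: `integral_one_sub_mul_rpow_eq` (`= (v − u) − s·∫ t^r`),
  `integral_one_sub_mul_rpow` (closed form `(v − u) − s·(v^{r+1} − u^{r+1})/(r+1)`, `r ≠ −1`, `u, v > 0`),
  `integral_one_sub_mul_rpow_nonneg`, `integral_one_sub_mul_rpow_le` (`≤ 2(v − u)`), `integral_one_sub_mul_rpow_mono`
  (monotone in the lower endpoint), `integral_one_sub_mul_rpow_pos` (`u < v`, `r < 0`).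
* §3 the world's constants: `betaExc_le_one` (unconditional), `betaExc_sub_one_lt_zero` / `betaExc_ne_zero` (`log D ≥ 43 250`),
  `siegelSign_of_not_isUnit`, `sum_siegelSign_eq_zero` (`χ ≠ χ₀`: `Σ_{a mod q} s(q,a) = 0`).
* §4 `θ_W` unfolded: `primeWorld_theta_of_isUnit` / `_of_not_isUnit`, `max_sub_max_le` (`max(x,1) − max(x−h,1) ≤ h`),
  `primeWorld_theta_nonneg`, `primeWorld_theta_mono` (in `h`), `primeWorld_theta_le` (`≤ 2h/φ(q)`), `primeWorld_theta_pos`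
  (`x > 1`, `h > 0`, unit `a`), `primeWorld_theta_eq_sub` (`= (Δ − s·∫ t^{β₁−1})/φ`), `primeWorld_theta_closed`
  (`= (Δ − s·(max(x,1)^{β₁} − max(x−h,1)^{β₁})/β₁)/φ`), `primeWorld_theta_self` (`h = x ≥ 1`),
  `primeWorld_theta_of_one_le_sub` (`x − h ≥ 1`: `= (h − s·(x^{β₁} − (x−h)^{β₁})/β₁)/φ`, the Thorner–Zaman main term
  `λ·h/φ(q)` exactly), `primeWorld_theta_one_zero` (`θ_W(x;1,0,h) = max(x,1) − max(x−h,1)`).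
* §5 the rows, with EXACTLY the field types of `PrimeMenu (world D χ) (primeWorld D χ)` under the binders of
  `MenuConsistentPrimes`: `world_rowS5_additive` (S5 clause 1), `world_rowS5_theta` (S5 clause 2), `world_rowP6` (P6, `C = 2`).

## References

* `pub/landau-siegel/B-dh/KILL-draft.md` §2 P7 / S5, §3 (the prime (A)-world); barrier/ASSIGNMENTS.md row S-E-p4-6.
* [Zhang2022LandauSiegel] §2 Assumption (A); [ThornerZaman2024PNTAP] Theorem 1 (1.4) p.3; [Xylouris2011Thesis] Theorem 2.1;
  [MontgomeryVaughan2007] §4.3 (orthogonality of characters), §11.2.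
-/

noncomputable section

open scoped Classical
open Complex MeasureTheory

namespace Literature.NumberTheory.LFunctions.Zhang2022.DH

/-! ### 1. The integrand `1 − s·t^r` on `t ≥ 1` -/

/-- `0 ≤ 1 − s·t^r` for `|s| ≤ 1`, `r ≤ 0`, `t ≥ 1` (`0 ≤ t^r ≤ 1`). [cite: ThornerZaman2024PNTAP, Theorem 1 (1.4) p.3] -/
theorem one_sub_mul_rpow_nonneg {s r t : ℝ} (hs : |s| ≤ 1) (hr : r ≤ 0) (ht : 1 ≤ t) : 0 ≤ 1 - s * t ^ r := by
  have h0 : 0 ≤ t ^ r := Real.rpow_nonneg (by linarith) r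
  have h1 : t ^ r ≤ 1 := Real.rpow_le_one_of_one_le_of_nonpos ht hr
  have h2 : s * t ^ r ≤ 1 :=
    calc s * t ^ r ≤ |s| * t ^ r := mul_le_mul_of_nonneg_right (le_abs_self s) h0
      _ ≤ 1 * 1 := mul_le_mul hs h1 h0 zero_le_one
      _ = 1 := one_mul 1
  linarith

/-- `1 − s·t^r ≤ 2` for `|s| ≤ 1`, `r ≤ 0`, `t ≥ 1`. [cite: ThornerZaman2024PNTAP, Theorem 1 (1.4) p.3] -/
theorem one_sub_mul_rpow_le_two {s r t : ℝ} (hs : |s| ≤ 1) (hr : r ≤ 0) (ht : 1 ≤ t) : 1 - s * t ^ r ≤ 2 := by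
  have h0 : 0 ≤ t ^ r := Real.rpow_nonneg (by linarith) r
  have h1 : t ^ r ≤ 1 := Real.rpow_le_one_of_one_le_of_nonpos ht hr
  have h2 : -s * t ^ r ≤ 1 :=
    calc -s * t ^ r ≤ |s| * t ^ r := mul_le_mul_of_nonneg_right (neg_le_abs s) h0
      _ ≤ 1 * 1 := mul_le_mul hs h1 h0 zero_le_one
      _ = 1 := one_mul 1
  linarith

/-- `0 < 1 − s·t^r` for `|s| ≤ 1`, `r < 0`, `t > 1` (`t^r < 1`). [cite: ThornerZaman2024PNTAP, Theorem 1 (1.4) p.3] -/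
theorem one_sub_mul_rpow_pos {s r t : ℝ} (hs : |s| ≤ 1) (hr : r < 0) (ht : 1 < t) : 0 < 1 - s * t ^ r := by
  have h0 : 0 ≤ t ^ r := Real.rpow_nonneg (by linarith) r
  have h1 : t ^ r < 1 := Real.rpow_lt_one_of_one_lt_of_neg ht hr
  have h2 : s * t ^ r < 1 :=
    calc s * t ^ r ≤ |s| * t ^ r := mul_le_mul_of_nonneg_right (le_abs_self s) h0
      _ ≤ 1 * t ^ r := mul_le_mul_of_nonneg_right hs h0
      _ < 1 := by rw [one_mul]; exact h1
  linarith

/-- `t ↦ 1 − s·t^r` is interval-integrable on any `[u, v]` with `u, v > 0`. [cite: ThornerZaman2024PNTAP, Theorem 1 (1.4) p.3] -/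
theorem intervalIntegrable_one_sub_mul_rpow (s r : ℝ) {u v : ℝ} (hu : 0 < u) (hv : 0 < v) :
    IntervalIntegrable (fun t : ℝ => 1 - s * t ^ r) volume u v :=
  intervalIntegrable_const.sub
    ((intervalIntegral.intervalIntegrable_rpow (Or.inr (Set.notMem_uIcc_of_lt hu hv))).const_mul s)

/-! ### 2. The interval integral of the integrand -/

/-- Linearity: `∫_u^v (1 − s·t^r) dt = (v − u) − s·∫_u^v t^r dt` (`u, v > 0`). [cite: ThornerZaman2024PNTAP, Theorem 1 (1.4) p.3] -/
theorem integral_one_sub_mul_rpow_eq (s r : ℝ) {u v : ℝ} (hu : 0 < u) (hv : 0 < v) :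
    ∫ t in u..v, (1 - s * t ^ r) = (v - u) - s * ∫ t in u..v, t ^ r := by
  have hI : IntervalIntegrable (fun t : ℝ => t ^ r) volume u v :=
    intervalIntegral.intervalIntegrable_rpow (Or.inr (Set.notMem_uIcc_of_lt hu hv))
  rw [intervalIntegral.integral_sub intervalIntegrable_const (hI.const_mul s), intervalIntegral.integral_const,
    intervalIntegral.integral_const_mul, smul_eq_mul, mul_one]

/-- Closed form: `∫_u^v (1 − s·t^r) dt = (v − u) − s·(v^{r+1} − u^{r+1})/(r+1)` for `u, v > 0`, `r ≠ −1`.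
[cite: ThornerZaman2024PNTAP, Theorem 1 (1.4) p.3] -/
theorem integral_one_sub_mul_rpow (s : ℝ) {r u v : ℝ} (hr : r ≠ -1) (hu : 0 < u) (hv : 0 < v) :
    ∫ t in u..v, (1 - s * t ^ r) = (v - u) - s * ((v ^ (r + 1) - u ^ (r + 1)) / (r + 1)) := by
  rw [integral_one_sub_mul_rpow_eq s r hu hv, integral_rpow (Or.inr ⟨hr, Set.notMem_uIcc_of_lt hu hv⟩)]

/-- `0 ≤ ∫_u^v (1 − s·t^r) dt` for `|s| ≤ 1`, `r ≤ 0`, `1 ≤ u ≤ v`. [cite: ThornerZaman2024PNTAP, Theorem 1 (1.4) p.3] -/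
theorem integral_one_sub_mul_rpow_nonneg {s r u v : ℝ} (hs : |s| ≤ 1) (hr : r ≤ 0) (hu : 1 ≤ u) (huv : u ≤ v) :
    0 ≤ ∫ t in u..v, (1 - s * t ^ r) :=
  intervalIntegral.integral_nonneg huv fun _ ht => one_sub_mul_rpow_nonneg hs hr (hu.trans ht.1)

/-- `∫_u^v (1 − s·t^r) dt ≤ 2(v − u)` for `|s| ≤ 1`, `r ≤ 0`, `1 ≤ u ≤ v`. [cite: ThornerZaman2024PNTAP, Theorem 1 (1.4) p.3] -/
theorem integral_one_sub_mul_rpow_le {s r u v : ℝ} (hs : |s| ≤ 1) (hr : r ≤ 0) (hu : 1 ≤ u) (huv : u ≤ v) :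
    ∫ t in u..v, (1 - s * t ^ r) ≤ 2 * (v - u) := by
  have h := intervalIntegral.integral_mono_on huv
    (intervalIntegrable_one_sub_mul_rpow s r (by linarith) (by linarith)) intervalIntegrable_const
    (fun t ht => one_sub_mul_rpow_le_two hs hr (hu.trans ht.1))
  rw [intervalIntegral.integral_const, smul_eq_mul] at h
  linarith

/-- Monotonicity in the lower endpoint: `∫_u^v ≤ ∫_{u'}^v` of `1 − s·t^r` for `1 ≤ u' ≤ u ≤ v` (the integrand is `≥ 0`).
[cite: ThornerZaman2024PNTAP, Theorem 1 (1.4) p.3] -/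
theorem integral_one_sub_mul_rpow_mono {s r u u' v : ℝ} (hs : |s| ≤ 1) (hr : r ≤ 0) (hu' : 1 ≤ u') (hu : u' ≤ u)
    (huv : u ≤ v) : ∫ t in u..v, (1 - s * t ^ r) ≤ ∫ t in u'..v, (1 - s * t ^ r) := by
  refine intervalIntegral.integral_mono_interval hu huv le_rfl ?_
    (intervalIntegrable_one_sub_mul_rpow s r (by linarith) (by linarith))
  exact ae_restrict_of_forall_mem measurableSet_Ioc fun t ht => one_sub_mul_rpow_nonneg hs hr (hu'.trans ht.1.le)

/-- `0 < ∫_u^v (1 − s·t^r) dt` for `|s| ≤ 1`, `r < 0`, `1 ≤ u < v`. [cite: Xylouris2011Thesis, Theorem 2.1] -/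
theorem integral_one_sub_mul_rpow_pos {s r u v : ℝ} (hs : |s| ≤ 1) (hr : r < 0) (hu : 1 ≤ u) (huv : u < v) :
    0 < ∫ t in u..v, (1 - s * t ^ r) :=
  intervalIntegral.intervalIntegral_pos_of_pos_on
    (intervalIntegrable_one_sub_mul_rpow s r (by linarith) (by linarith))
    (fun _ ht => one_sub_mul_rpow_pos hs hr (lt_of_le_of_lt hu ht.1)) huv

/-! ### 3. The world's constants -/

/-- `β₁(D) ≤ 1` for EVERY `D` (`λ(D) = 1/(2 log^{2022} D) ≥ 0`). [cite: Zhang2022LandauSiegel, §2 Assumption (A)] -/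
theorem betaExc_le_one (D : ℕ) : betaExc D ≤ 1 := by
  unfold betaExc lam
  have h2 : (0 : ℝ) ≤ Real.log D ^ 2022 := by positivity
  have h3 : (0 : ℝ) ≤ 1 / (2 * Real.log D ^ 2022) := by positivity
  have h4 : (0 : ℝ) ≤ 1 / (2 * Real.log D ^ 2022) / 0.75 := div_nonneg h3 (by norm_num)
  linarith

/-- The exponent of the prime world is negative: `β₁(D) − 1 < 0` (`log D ≥ 43 250`). [cite: BenliGoelTwissZaman2025, Corollary 1.1] -/
theorem betaExc_sub_one_lt_zero {D : ℕ} (hL : (43250 : ℝ) ≤ Real.log D) : betaExc D - 1 < 0 := by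
  linarith [(betaExc_window hL).2]

/-- `β₁(D) ≠ 0` (indeed `> ½`, `log D ≥ 43 250`). [cite: BenliGoelTwissZaman2025, Corollary 1.1] -/
theorem betaExc_ne_zero {D : ℕ} (hL : (43250 : ℝ) ≤ Real.log D) : betaExc D ≠ 0 := by
  intro h; linarith [half_lt_betaExc hL]

section SignSums

variable {D : ℕ} (χ : DirichletCharacter ℂ D)

/-- The sign datum vanishes on non-units: `s(q,a) = 0` if `a` is not a unit mod `q` (a character is `0` off the units).
[cite: MontgomeryVaughan2007, §4.3] -/
theorem siegelSign_of_not_isUnit {q : ℕ} {a : ZMod q} (ha : ¬ IsUnit a) : siegelSign D χ q a = 0 := by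
  unfold siegelSign
  split_ifs with h
  · rw [MulChar.map_nonunit _ ha, Complex.zero_re]
  · rfl

/-- Orthogonality: `Σ_{a mod q} s(q,a) = 0` for `χ ≠ χ₀` (the induced character `ψ ≠ χ₀` has `Σ_a ψ(a) = 0`; off the induced
moduli `s ≡ 0`). [cite: MontgomeryVaughan2007, §4.3] -/
theorem sum_siegelSign_eq_zero (hχ : χ ≠ 1) (q : ℕ) [NeZero q] : ∑ a : ZMod q, siegelSign D χ q a = 0 := by
  unfold siegelSign
  by_cases hq : D ∣ q
  · simp only [dif_pos hq]
    rw [← Complex.re_sum, MulChar.sum_eq_zero_of_ne_one, Complex.zero_re]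
    rwa [Ne, DirichletCharacter.changeLevel_eq_one_iff]
  · simp only [dif_neg hq, Finset.sum_const_zero]

/-- Counting units: `Σ_{a mod q} [a unit]·c = φ(q)·c`. [cite: MontgomeryVaughan2007, §4.3] -/
theorem sum_ite_isUnit_const (q : ℕ) [NeZero q] (c : ℝ) :
    ∑ a : ZMod q, (if IsUnit a then c else 0) = (Nat.totient q : ℝ) * c := by
  have h1 : ∀ a : ZMod q, (if IsUnit a then c else 0) = (if IsUnit a then (1 : ℝ) else 0) * c := by
    intro a; split_ifs <;> simp
  simp only [h1]
  rw [← Finset.sum_mul, Finset.sum_boole]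
  congr 1
  have h2 : (Finset.univ : Finset (ZMod q)).filter IsUnit =
      Finset.univ.map ⟨((↑) : (ZMod q)ˣ → ZMod q), Units.val_injective⟩ := by
    ext a
    simp [IsUnit]
  rw [h2, Finset.card_map, Finset.card_univ, ZMod.card_units_eq_totient]

end SignSums

/-! ### 4. `θ_W` unfolded, bounded, monotone, positive, in closed form -/

/-- `max(x,1) − max(x−h,1) ≤ h` for `h ≥ 0` (`max(·,1)` is 1-Lipschitz). [cite: ThornerZaman2024PNTAP, Theorem 1 (1.4) p.3] -/
theorem max_sub_max_le (x : ℝ) {h : ℝ} (hh : 0 ≤ h) : max x 1 - max (x - h) 1 ≤ h := by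
  have h1 := abs_max_sub_max_le_abs x (x - h) 1
  rw [show x - (x - h) = h by ring, abs_of_nonneg hh] at h1
  exact (le_abs_self _).trans h1

section PrimeWorld

variable {D : ℕ} (χ : DirichletCharacter ℂ D)

/-- `θ_W` on a unit class: `θ_W(x;q,a,h) = (1/φ(q)) ∫_{max(x−h,1)}^{max(x,1)} (1 − s(q,a) t^{β₁−1}) dt`.
[cite: ThornerZaman2024PNTAP, Theorem 1 (1.4) p.3] -/
theorem primeWorld_theta_of_isUnit {q : ℕ} {a : ZMod q} (ha : IsUnit a) (x h : ℝ) :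
    (primeWorld D χ).theta q a x h =
      (∫ t in max (x - h) 1..max x 1, (1 - siegelSign D χ q a * t ^ (betaExc D - 1))) / Nat.totient q := by
  show (if IsUnit a then (∫ t in max (x - h) 1..max x 1, (1 - siegelSign D χ q a * t ^ (betaExc D - 1))) /
      Nat.totient q else 0) = _
  rw [if_pos ha]

/-- `θ_W` vanishes on non-unit classes. [cite: ThornerZaman2024PNTAP, Theorem 1 (1.4) p.3] -/
theorem primeWorld_theta_of_not_isUnit {q : ℕ} {a : ZMod q} (ha : ¬ IsUnit a) (x h : ℝ) :
    (primeWorld D χ).theta q a x h = 0 := by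
  show (if IsUnit a then (∫ t in max (x - h) 1..max x 1, (1 - siegelSign D χ q a * t ^ (betaExc D - 1))) /
      Nat.totient q else 0) = _
  rw [if_neg ha]

/-- `θ_W(x;q,a,h) ≥ 0` for `h ≥ 0` (every `D`, `q`, `a`, `x`). [cite: ThornerZaman2024PNTAP, Theorem 1 (1.4) p.3] -/
theorem primeWorld_theta_nonneg (q : ℕ) (a : ZMod q) (x : ℝ) {h : ℝ} (hh : 0 ≤ h) :
    0 ≤ (primeWorld D χ).theta q a x h := by
  by_cases ha : IsUnit a
  · rw [primeWorld_theta_of_isUnit χ ha]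
    exact div_nonneg (integral_one_sub_mul_rpow_nonneg (abs_siegelSign_le D χ q a)
      (sub_nonpos.mpr (betaExc_le_one D)) (le_max_right _ _) (max_le_max (by linarith) le_rfl)) (Nat.cast_nonneg _)
  · rw [primeWorld_theta_of_not_isUnit χ ha]

/-- `θ_W(x;q,a,·)` is non-decreasing on `0 ≤ h ≤ h'` (every `D`, `q`, `a`, `x`). [cite: ThornerZaman2024PNTAP, Theorem 1 (1.4) p.3] -/
theorem primeWorld_theta_mono (q : ℕ) (a : ZMod q) (x : ℝ) {h h' : ℝ} (hh : 0 ≤ h) (hhh' : h ≤ h') :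
    (primeWorld D χ).theta q a x h ≤ (primeWorld D χ).theta q a x h' := by
  by_cases ha : IsUnit a
  · rw [primeWorld_theta_of_isUnit χ ha, primeWorld_theta_of_isUnit χ ha]
    exact div_le_div_of_nonneg_right (integral_one_sub_mul_rpow_mono (abs_siegelSign_le D χ q a)
      (sub_nonpos.mpr (betaExc_le_one D)) (le_max_right _ _) (max_le_max (by linarith) le_rfl)
      (max_le_max (by linarith) le_rfl)) (Nat.cast_nonneg _)
  · rw [primeWorld_theta_of_not_isUnit χ ha, primeWorld_theta_of_not_isUnit χ ha]

/-- `θ_W(x;q,a,h) ≤ 2h/φ(q)` for `h ≥ 0` (integrand `≤ 2` on an interval of length `≤ h`).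
[cite: ThornerZaman2024PNTAP, Theorem 1 (1.4) p.3] -/
theorem primeWorld_theta_le (q : ℕ) (a : ZMod q) (x : ℝ) {h : ℝ} (hh : 0 ≤ h) :
    (primeWorld D χ).theta q a x h ≤ 2 * h / Nat.totient q := by
  by_cases ha : IsUnit a
  · rw [primeWorld_theta_of_isUnit χ ha]
    refine div_le_div_of_nonneg_right ?_ (Nat.cast_nonneg _)
    have h1 := integral_one_sub_mul_rpow_le (abs_siegelSign_le D χ q a) (sub_nonpos.mpr (betaExc_le_one D))
      (le_max_right (x - h) 1) (max_le_max (sub_le_self x hh) (le_refl (1 : ℝ)))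
    have h2 := max_sub_max_le x hh
    linarith
  · rw [primeWorld_theta_of_not_isUnit χ ha]
    exact div_nonneg (by linarith) (Nat.cast_nonneg _)

/-- `θ_W(x;q,a,h) > 0` for a unit `a`, `x > 1`, `h > 0` (`log D ≥ 43 250`: the integrand is `> 0` on `t > 1`, `φ(q) ≥ 1`).
[cite: Xylouris2011Thesis, Theorem 2.1] -/
theorem primeWorld_theta_pos (hL : (43250 : ℝ) ≤ Real.log D) {q : ℕ} [NeZero q] {a : ZMod q} (ha : IsUnit a)
    {x h : ℝ} (hx : 1 < x) (hh : 0 < h) : 0 < (primeWorld D χ).theta q a x h := by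
  rw [primeWorld_theta_of_isUnit χ ha]
  have hφ : (0 : ℝ) < Nat.totient q := by exact_mod_cast Nat.totient_pos.mpr (NeZero.pos q)
  refine div_pos (integral_one_sub_mul_rpow_pos (abs_siegelSign_le D χ q a) (betaExc_sub_one_lt_zero hL)
    (le_max_right _ _) ?_) hφ
  rw [max_eq_left hx.le]
  exact max_lt (by linarith) hx

/-- `θ_W = (Δ − s·∫_{max(x−h,1)}^{max(x,1)} t^{β₁−1} dt)/φ(q)` with `Δ = max(x,1) − max(x−h,1)`, unit `a` (every `D`).
[cite: ThornerZaman2024PNTAP, Theorem 1 (1.4) p.3] -/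
theorem primeWorld_theta_eq_sub {q : ℕ} {a : ZMod q} (ha : IsUnit a) (x h : ℝ) :
    (primeWorld D χ).theta q a x h =
      ((max x 1 - max (x - h) 1) - siegelSign D χ q a * ∫ t in max (x - h) 1..max x 1, t ^ (betaExc D - 1)) /
        Nat.totient q := by
  rw [primeWorld_theta_of_isUnit χ ha, integral_one_sub_mul_rpow_eq _ _ (lt_of_lt_of_le one_pos (le_max_right _ _))
    (lt_of_lt_of_le one_pos (le_max_right _ _))]

/-- CLOSED FORM: `θ_W(x;q,a,h) = (max(x,1) − max(x−h,1) − s·(max(x,1)^{β₁} − max(x−h,1)^{β₁})/β₁)/φ(q)` for a unit `a`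
(`log D ≥ 43 250`, so `β₁ ≠ 0`). [cite: ThornerZaman2024PNTAP, Theorem 1 (1.4) p.3] -/
theorem primeWorld_theta_closed (hL : (43250 : ℝ) ≤ Real.log D) {q : ℕ} {a : ZMod q} (ha : IsUnit a) (x h : ℝ) :
    (primeWorld D χ).theta q a x h =
      ((max x 1 - max (x - h) 1) -
          siegelSign D χ q a * ((max x 1 ^ betaExc D - max (x - h) 1 ^ betaExc D) / betaExc D)) / Nat.totient q := by
  have hr : betaExc D - 1 ≠ -1 := by
    intro h; exact betaExc_ne_zero hL (by linarith)
  rw [primeWorld_theta_of_isUnit χ ha, integral_one_sub_mul_rpow _ hr (lt_of_lt_of_le one_pos (le_max_right _ _))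
    (lt_of_lt_of_le one_pos (le_max_right _ _)), sub_add_cancel]

/-- The diagonal case `h = x ≥ 1`: `θ_W(x;q,a,x) = ((x − 1) − s·(x^{β₁} − 1)/β₁)/φ(q)` for a unit `a` (`log D ≥ 43 250`).
[cite: ThornerZaman2024PNTAP, Corollary 5 p.4] -/
theorem primeWorld_theta_self (hL : (43250 : ℝ) ≤ Real.log D) {q : ℕ} {a : ZMod q} (ha : IsUnit a) {x : ℝ}
    (hx : 1 ≤ x) :
    (primeWorld D χ).theta q a x x =
      ((x - 1) - siegelSign D χ q a * ((x ^ betaExc D - 1) / betaExc D)) / Nat.totient q := by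
  rw [primeWorld_theta_closed χ hL ha, sub_self, max_eq_left hx, max_eq_right (zero_le_one' ℝ), Real.one_rpow]

/-- The short-interval case `x − h ≥ 1`, `h ≥ 0`: `θ_W(x;q,a,h) = (h − s·(x^{β₁} − (x−h)^{β₁})/β₁)/φ(q)` for a unit `a` — the
Thorner–Zaman main term `λ·h/φ(q)` EXACTLY (`log D ≥ 43 250`). [cite: ThornerZaman2024PNTAP, Theorem 1 (1.4) p.3] -/
theorem primeWorld_theta_of_one_le_sub (hL : (43250 : ℝ) ≤ Real.log D) {q : ℕ} {a : ZMod q} (ha : IsUnit a)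
    {x h : ℝ} (hh : 0 ≤ h) (hxh : 1 ≤ x - h) :
    (primeWorld D χ).theta q a x h =
      (h - siegelSign D χ q a * ((x ^ betaExc D - (x - h) ^ betaExc D) / betaExc D)) / Nat.totient q := by
  rw [primeWorld_theta_closed χ hL ha, max_eq_left (by linarith : (1 : ℝ) ≤ x), max_eq_left hxh]
  congr 1
  ring

/-- The trivial modulus: `θ_W(x;1,0,h) = max(x,1) − max(x−h,1)` (`D ≠ 1`, so `D ∤ 1` and `s ≡ 0`; `φ(1) = 1`).
[cite: ThornerZaman2024PNTAP, Theorem 1 (1.4) p.3] -/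
theorem primeWorld_theta_one_zero (hD : D ≠ 1) (x h : ℝ) :
    (primeWorld D χ).theta 1 0 x h = max x 1 - max (x - h) 1 := by
  rw [primeWorld_theta_of_not_dvd χ (fun h1 => hD (Nat.dvd_one.mp h1)) (isUnit_of_subsingleton _) x h,
    Nat.totient_one, Nat.cast_one, div_one]

/-! ### 5. Rows S5 (clauses 1–2) and P6 of `PrimeMenu (world D χ) (primeWorld D χ)` -/

/-- **Row S5, clause 1 (additivity over residue classes)**: `Σ_{a mod q} θ_W(x;q,a,h) = θ_W(x;1,0,h)` — `#(ℤ/q)ˣ = φ(q)`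
copies of the length term and `Σ_a s(q,a) = 0` (`χ ≠ χ₀`; `log D ≥ 43 250` only through `D ≠ 1`). EXACTLY the first conjunct
of `PrimeMenu.rowS5` at `(world D χ) (primeWorld D χ)`. [cite: Zhang2022LandauSiegel, §2 Assumption (A)] -/
theorem world_rowS5_additive (hχ : χ ≠ 1) (hL : (43250 : ℝ) ≤ Real.log D) :
    ∀ (q : ℕ) [NeZero q] (x h : ℝ), ∑ a : ZMod q, (primeWorld D χ).theta q a x h = (primeWorld D χ).theta 1 0 x h := by
  intro q _ x h
  have hD : D ≠ 1 := by
    intro h1; rw [h1, Nat.cast_one, Real.log_one] at hL; linarith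
  rw [primeWorld_theta_one_zero χ hD]
  set Δ : ℝ := max x 1 - max (x - h) 1 with hΔ
  set I : ℝ := ∫ t in max (x - h) 1..max x 1, t ^ (betaExc D - 1) with hI
  have hterm : ∀ a : ZMod q, (primeWorld D χ).theta q a x h =
      (if IsUnit a then Δ / Nat.totient q else 0) - siegelSign D χ q a * (I / Nat.totient q) := by
    intro a
    by_cases ha : IsUnit a
    · rw [primeWorld_theta_eq_sub χ ha, if_pos ha]
      ring
    · rw [primeWorld_theta_of_not_isUnit χ ha, if_neg ha, siegelSign_of_not_isUnit χ ha]
      ring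
  have hφ : (Nat.totient q : ℝ) ≠ 0 := by exact_mod_cast (Nat.totient_pos.mpr (NeZero.pos q)).ne'
  rw [Finset.sum_congr rfl fun a _ => hterm a, Finset.sum_sub_distrib, ← Finset.sum_mul, sum_siegelSign_eq_zero χ hχ q,
    zero_mul, sub_zero, sum_ite_isUnit_const, mul_div_cancel₀ _ hφ]

/-- **Row S5, clause 2 (`θ_W ≥ 0` and non-decreasing in `h`)** — EXACTLY the second conjunct of `PrimeMenu.rowS5` at
`(world D χ) (primeWorld D χ)`; holds for every `D` (the hypothesis `h' ≤ x` is not needed).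
[cite: Zhang2022LandauSiegel, §2 Assumption (A)] -/
theorem world_rowS5_theta :
    ∀ (q : ℕ) [NeZero q] (a : ZMod q) (x h h' : ℝ), 0 ≤ h → h ≤ h' → h' ≤ x →
      0 ≤ (primeWorld D χ).theta q a x h ∧ (primeWorld D χ).theta q a x h ≤ (primeWorld D χ).theta q a x h' :=
  fun q _ a x _ _ hh hhh' _ => ⟨primeWorld_theta_nonneg χ q a x hh, primeWorld_theta_mono χ q a x hh hhh'⟩

/-- **Row P6 (Linnik / Xylouris `P(q) ≤ Cq⁵`, read on the data)** with `C = 2`: `θ_W(2q⁵; q, a, 2q⁵) > 0` for every unit `a`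
mod `q ≥ 1` (`2q⁵ ≥ 2 > 1`; `log D ≥ 43 250`). EXACTLY the type of `PrimeMenu.rowP6` at `(world D χ) (primeWorld D χ)`.
[cite: Xylouris2011Thesis, Theorem 2.1] -/
theorem world_rowP6 (hL : (43250 : ℝ) ≤ Real.log D) :
    ∃ C : ℝ, 0 < C ∧ ∀ (q : ℕ) [NeZero q], 1 ≤ q → ∀ a : ZMod q, IsUnit a →
      0 < (primeWorld D χ).theta q a (C * (q : ℝ) ^ (5 : ℕ)) (C * (q : ℝ) ^ (5 : ℕ)) := by
  refine ⟨2, two_pos, fun q _ hq a ha => ?_⟩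
  have hq1 : (1 : ℝ) ≤ q := by exact_mod_cast hq
  have hq5 : (1 : ℝ) ≤ (q : ℝ) ^ (5 : ℕ) := one_le_pow₀ hq1
  have hX : (1 : ℝ) < 2 * (q : ℝ) ^ (5 : ℕ) := by linarith
  exact primeWorld_theta_pos χ hL ha hX (by linarith)

/-! ### 6. Probes: the row theorems have EXACTLY the field types (proof irrelevance `rfl` type-checks only if the
projection of an assumed `PrimeMenu (world D χ) (primeWorld D χ)` and the theorem inhabit the same proposition) -/

/-- PROBE S5 clause 1: `world_rowS5_additive` IS the first conjunct of the field `rowS5`. [cite: Zhang2022LandauSiegel, §2 Assumption (A)] -/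
example (hχ : χ ≠ 1) (hL : (43250 : ℝ) ≤ Real.log D) (M : PrimeMenu (world D χ) (primeWorld D χ)) :
    M.rowS5.1 = world_rowS5_additive χ hχ hL := rfl

/-- PROBE S5 clause 2: `world_rowS5_theta` IS the second conjunct of the field `rowS5`. [cite: Zhang2022LandauSiegel, §2 Assumption (A)] -/
example (M : PrimeMenu (world D χ) (primeWorld D χ)) : M.rowS5.2.1 = world_rowS5_theta χ := rfl

/-- PROBE P6: `world_rowP6` IS the field `rowP6`. [cite: Xylouris2011Thesis, Theorem 2.1] -/
example (hL : (43250 : ℝ) ≤ Real.log D) (M : PrimeMenu (world D χ) (primeWorld D χ)) :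
    M.rowP6 = world_rowP6 χ hL := rfl

end PrimeWorld

end Literature.NumberTheory.LFunctions.Zhang2022.DH

end
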